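import Literature.NumberTheory.Sieve.FriedlanderIwaniecPrimes
import HarnessLib

/-!
# Friedlander–Iwaniec, Proposition 4.1: what the tree's named fact says at nonpositive sieving parameters

Family `parity`, statement parity.S17. Source: J. Friedlander, H. Iwaniec, Ann. of Math. (2) 148
(1998), 945–1040 [FriedlanderIwaniecAnnals1998], Proposition 4.1 with (4.3)–(4.6), and (2.15).

A faithfulness note on the named fact `Literature.NumberTheory.Sieve.FriedlanderIwaniec1998_prop41`
(`FriedlanderIwaniecPrimes.lean`), made machine-checked. The fact quantifies over ALL real `P`,
constrained only through `Real.log P` ((4.4) `(log log x)² ≤ log P ≤ (log x)(log log x)⁻²`).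
Mathlib's `Real.log` is even (`Real.log_neg_eq_log`), so every NEGATIVE `P` with `|P|` in the range
(4.4) is admitted, and for `P ≤ 0` the sifting condition of `SieveSequence.fiBilinearPi` — every
prime factor of `n` is `≥ P`, i.e. (4.21) `(n, Π) = 1` — holds vacuously (`sift_vacuous`,
`fiBilinearPi_of_nonpos`). Consequently the fact implies (4.5) for the UNSIFTED coefficients
`β(n) = μ(n) γ(n, C)` (`unsifted_of_prop41`), i.e. Proposition 4.1 with `Π = 1`.

The source does not print that. `P` is the sieving parameter of (2.15): "`Π` is the product of all
primes `p < P` with `P` which can be chosen at will subject to `2 ≤ P ≤ Δ^{1/2^{35} log log x}`";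
Proposition 4.1 is stated for `P` in (4.4); and (p. 959, after (4.4)) "Although the sieve does not
require any lower bound for `P`, that is `Π = 1` is permissible, we introduce this as a technical
device which greatly simplifies a large number of computations. With slightly more work we could
relax the lower bound for `P` to a suitably large power of `log x` and still obtain the same results"
— the lower bound may be relaxed to a power of `log x`, it is not removed, and the printed proof of
(4.23) uses `P ≥ (log x)^{A+A'}` ((5.10)–(5.11) "The second condition requires `P ≥ (log x)^{A+A'}`",
(5.24), Proposition 10.2). So the tree's fact is STRONGER than Proposition 4.1 as printed, through the
junk value of `log` at negative reals; the statement as printed is the same with `0 < P` (all uses in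
the tree take `P = fiP x = exp((log log x)²) > 0`: `hyp211_of_prop41`, `hyp211_sq`). This file proves
theorems only; it neither repairs nor restates the fact (that is a reviewed statement change).

## References

* J. Friedlander, H. Iwaniec, Ann. of Math. (2) 148 (1998), 945–1040: Proposition 4.1, (4.3)–(4.6),
  (4.21), (2.11)–(2.15), p. 959. [FriedlanderIwaniecAnnals1998]
-/

noncomputable section

open Filter Finset Real
open scoped ArithmeticFunction.Moebius

namespace Literature.NumberTheory.Sieve

open FriedlanderIwaniecPrimes SieveSequence

/-- For `P ≤ 0` the sifting condition "every prime factor of `n` is `≥ P`" ((4.21) `(n, Π) = 1` in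
`SieveSequence.fiBilinearPi`) holds for every `n`. [folklore] -/
theorem FriedlanderIwaniecPrimes.sift_vacuous {P : ℝ} (hP : P ≤ 0) (n : ℕ) :
    ∀ p ∈ n.primeFactors, P ≤ (p : ℝ) :=
  fun p _ => hP.trans (Nat.cast_nonneg p)

/-- At a nonpositive `P`, `B(x; N)` of (4.3) (`SieveSequence.fiBilinearPi`) is the UNSIFTED bilinear
form `Σ_m |Σ_{N < n ≤ 2N, mn ≤ x, (n, m) = 1} μ(n) γ(n, C) a_{mn}|` — no condition `(n, Π) = 1`.
[cite: FriedlanderIwaniecAnnals1998, (4.3) and (2.11)-(2.12)] -/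
theorem FriedlanderIwaniecPrimes.fiBilinearPi_of_nonpos (A : SieveSequence) (x N C : ℝ) {P : ℝ}
    (hP : P ≤ 0) :
    A.fiBilinearPi x N C P = ∑ m ∈ Icc 1 ⌊x⌋₊,
      |∑ n ∈ (Ioc ⌊N⌋₊ ⌊2 * N⌋₊).filter (fun n : ℕ => ((m * n : ℕ) : ℝ) ≤ x ∧ n.Coprime m),
        (μ n : ℝ) * (fiGamma C n : ℝ) * A.a (m * n)| := by
  rw [fiBilinearPi_def]
  refine sum_congr rfl fun m _ => ?_
  congr 1
  refine sum_congr ?_ fun _ _ => rfl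
  ext n
  simp only [mem_filter]
  constructor
  · rintro ⟨h1, h2, h3, -⟩; exact ⟨h1, h2, h3⟩
  · rintro ⟨h1, h2, h3⟩; exact ⟨h1, h2, h3, sift_vacuous hP n⟩

/-- **What `FriedlanderIwaniec1998_prop41` asserts beyond the source**: the bound (4.5)
`B(x; N) ≤ K A(x) (log x)^{4-A}` for the UNSIFTED form (no `(n, Π) = 1`), for every positive `P` in
the range (4.4), all `N` in (4.6) and `1 ≤ C ≤ N^{1-η}` — obtained by applying the fact at `-P`
(`Real.log (-P) = Real.log P`). Proposition 4.1 as printed assumes `(n, Π) = 1` with `Π` the product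
of the primes `p < P`, `2 ≤ P` ((2.15)), `log P ≥ (log log x)²` ((4.4)); the case `Π = 1` is not
claimed there (p. 959). [cite: FriedlanderIwaniecAnnals1998, Proposition 4.1 and p. 959] -/
theorem FriedlanderIwaniecPrimes.unsifted_of_prop41 (h : FriedlanderIwaniec1998_prop41) :
    ∀ η : ℝ, 0 < η → ∀ A : ℝ, 0 < A → ∃ B : ℝ, 0 < B ∧ ∃ K : ℝ, ∀ᶠ x : ℝ in atTop,
    ∀ P : ℝ, 0 < P → Real.log (Real.log x) ^ 2 ≤ Real.log P →
      Real.log P ≤ Real.log x * (Real.log (Real.log x))⁻¹ ^ 2 →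
    ∀ N : ℝ, x ^ (1 / 4 + η : ℝ) < N → N < x ^ (1 / 2 : ℝ) / Real.log x ^ B →
    ∀ C : ℝ, 1 ≤ C → C ≤ N ^ (1 - η : ℝ) →
      (∑ m ∈ Icc 1 ⌊x⌋₊,
        |∑ n ∈ (Ioc ⌊N⌋₊ ⌊2 * N⌋₊).filter (fun n : ℕ => ((m * n : ℕ) : ℝ) ≤ x ∧ n.Coprime m),
          (μ n : ℝ) * (fiGamma C n : ℝ) * fiSieveSeq.a (m * n)|) ≤
        K * fiCount x * Real.log x ^ (4 - A : ℝ) := by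
  intro η hη A hA
  obtain ⟨B, hB, K, hev⟩ := h η hη A hA
  refine ⟨B, hB, K, ?_⟩
  filter_upwards [hev] with x hx
  intro P hP hP1 hP2 N hN1 hN2 C hC1 hC2
  have hlog : Real.log (-P) = Real.log P := Real.log_neg_eq_log P
  have h := hx (-P) (by rw [hlog]; exact hP1) (by rw [hlog]; exact hP2) N hN1 hN2 C hC1 hC2
  rwa [fiBilinearPi_of_nonpos _ _ _ _ (by linarith : -P ≤ 0)] at h

/-- The printed reading is the special case `0 < P` of the tree's fact: whatever is eventually
proved for positive sieving parameters is implied by (not equivalent to) the fact as vendored.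
[cite: FriedlanderIwaniecAnnals1998, Proposition 4.1] -/
theorem FriedlanderIwaniecPrimes.prop41_pos_of_prop41 (h : FriedlanderIwaniec1998_prop41) :
    ∀ η : ℝ, 0 < η → ∀ A : ℝ, 0 < A → ∃ B : ℝ, 0 < B ∧ ∃ K : ℝ, ∀ᶠ x : ℝ in atTop,
    ∀ P : ℝ, 0 < P → Real.log (Real.log x) ^ 2 ≤ Real.log P →
      Real.log P ≤ Real.log x * (Real.log (Real.log x))⁻¹ ^ 2 →
    ∀ N : ℝ, x ^ (1 / 4 + η : ℝ) < N → N < x ^ (1 / 2 : ℝ) / Real.log x ^ B →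
    ∀ C : ℝ, 1 ≤ C → C ≤ N ^ (1 - η : ℝ) →
      fiSieveSeq.fiBilinearPi x N C P ≤ K * fiCount x * Real.log x ^ (4 - A : ℝ) := by
  intro η hη A hA
  obtain ⟨B, hB, K, hev⟩ := h η hη A hA
  refine ⟨B, hB, K, ?_⟩
  filter_upwards [hev] with x hx
  intro P _ hP1 hP2
  exact hx P hP1 hP2

end Literature.NumberTheory.Sieve
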